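import Literature.AlgebraicGeometry.Hyperkaehler.GeneralizedKummerTypeFixedFourfold
import Literature.AlgebraicGeometry.Hyperkaehler.GeneralizedKummerType
import Literature.AlgebraicGeometry.HodgeTheory.ComplexOrientationFamily
import Literature.AlgebraicTopology.SingularHomology.CohomologyRingChange
import HarnessLib

/-!
# Parallel transport of the Kummer fixed fourfold and of `Γ(X)` from a Kummer point (Hassett–Tschinkel 2013 Thm. 2.1, Floccari 2026 Prop. 4.6, Kamenova–Mongardi–Oblomkov 2022 Cor. 4.4) — NAMED FACT

Layer `Literature/AlgebraicGeometry/Hyperkaehler`.  CITE record for the cell `hodge-kum4` (ladder HodgeAV,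
rung H3 = the Hodge conjecture for every smooth projective variety of `Kum⁴`-type; seat p2, memo
HOME/p2/I1GEO-SPLIT-OPTION.md).  A purely COHOMOLOGICAL transport statement: the middle cohomology of
a smooth projective `X` of `Kum⁴`-type, with its action of `Γ(X)` (automorphisms trivial on `H² ⊕ H³`)
and the class of the Kummer fixed fourfold `W_X` (file `GeneralizedKummerTypeFixedFourfold`), is
isomorphic — `Γ`-equivariantly and class-to-class — to that of a generalized Kummer variety `K⁴(A)`
with its translation group `A[5]` and the class of `Km(A)^[2] ⊂ K⁴(A)`.  It lets the cell state the
only non-print residual of the rung at the Kummer varieties `K⁴(A)` themselves (explicit algebraic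
varieties) instead of on every deformation.

## Sources (read at the page; held arXiv texts)

* B. Hassett, Yu. Tschinkel, *Hodge theory and Lagrangian planes on generalized Kummer fourfolds*,
  Mosc. Math. J. 13 (2013) [`HassettTschinkel2013`, REFEREED], Theorem 2.1 (arXiv:1004.0046 p. 3,
  L28–L33), VERBATIM: "Let `X'` be deformation equivalent to `X`, i.e., there exists a connected complex
  manifold `B`, with distinguished points `b` and `b'`, and a proper family of complex manifolds
  `π : 𝒳 → B` with `𝒳_b = X` and `𝒳_{b'} = X'`. **Theorem 2.1.** `Aut°(X)` is a deformation invariant of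
  `X`, i.e., there exists a local system of groups `Aut°(𝒳/B) → B` acting on `𝒳 → B`, such that for each
  `b' ∈ B` the fiber is isomorphic to `Aut°(X')`."  Here `Aut°` = automorphisms acting trivially on
  `H²(·, ℤ)`; for `Kumⁿ`-type, `Aut° ≅ (ℤ/(n+1))⁴ ⋊ ℤ/2 ⊃ Γ` (ibid. §3; Boissière–Nieper-Wißkirchen–Sarti
  2011 Cor. 3.3(2); Oguiso 2020).  Consequence used: along the family, parallel transport in `H⁸` is
  equivariant for the identification of the stalks of this local system, which carries `Γ(𝒳_b)` (the
  elements acting trivially on `H² ⊕ H³`, a condition preserved by transport) onto `Γ(𝒳_{b'})`.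
* S. Floccari, *K3 surfaces associated with varieties of generalized Kummer type*, Geom. Topol. 30
  (2026) 1129–1154 [`Floccari2026`, REFEREED], Proposition 4.6 (arXiv:2501.02315 p. 14, L11–L22),
  VERBATIM: "Let `𝒦 → B` be a smooth proper family of complex manifolds of `Kumⁿ`-type over a connected
  manifold `B`, such that for some `0 ∈ B` we have `𝒦_0 = Kⁿ(A)` […]. Then, up to a finite étale
  base-change, there exist a smooth and proper family `𝒲 → B` of manifolds of `K3^[m]`-type with
  `𝒲_0 = Km(A)^[m]` and a closed embedding `ι : 𝒲 ↪ 𝒦` over `B` extending `ι_0`", and, after it: "the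
  cohomology class `[ι(Km(A)^[m])]` remains algebraic, and in particular a Hodge class, on any
  deformation of `Kⁿ(A)`" — i.e. the parallel transport of `[W₀]` is the class `[𝒲_b]` of the fibre of
  the family of fixed fourfolds (Gauss–Manin flatness of the classes of the fibres of a smooth proper
  subfamily; Ehresmann).  Lemma 4.2 (p. 10, L13–L33): `W` is THE unique component of maximal dimension
  of `Fix(−1)` (after Kamenova–Mongardi–Oblomkov).
* L. Kamenova, G. Mongardi, A. Oblomkov, *Symplectic involutions of `K3^[n]` type and Kummer `n` type
  manifolds*, Bull. LMS 54 (2022) [`KamenovaMongardiOblomkov2022`, REFEREED], Definition 2.1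
  (arXiv:1809.02810 p. 4, L8–L22: "deformation of the pair `(X, G)`": a smooth family over a connected
  base with a fibrewise faithful `G`-action) and Corollary 4.4 (p. 8): "Let `X` be a manifold of Kummer
  `n` type and let `ι` be a symplectic involution. Then […] the pair `(X, ι)` is deformation equivalent
  to the pair `(K_n(A), −1)` and our claim holds" (the fixed locus of `ι` has the form of that of `−1`).
* The involutions of `Aut₀(X) ∖ Γ(X)` form ONE `Γ(X)`-conjugacy class (`|Γ(X)| = 625` odd:
  `h ι h⁻¹ = h² ι`; Floccari 2023 §2.5, "`Aut₀ = A₄ ⋊ ⟨−1⟩`, the second factor acting on the first as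
  the inverse" [`Floccari2023`]), so an arbitrary Kummer fixed datum `(ι, W, i)` on `X` differs from the
  transported one by conjugation with some `h ∈ Γ(X)`, which replaces `(P, θ, W)` below by
  `((h⁻¹)^* ∘ P, c_h ∘ θ, hW)` — elementary.

## Rendering (tree carriers) and faithfulness

For `X` smooth projective of dimension `8` of `Kum⁴`-type, a Kummer fixed datum
`Hyperkaehler.IsKummerFixedDatum X ι W i` (file `GeneralizedKummerTypeFixedFourfold`; `W` smooth
projective of dimension `4`) and the integral Poincaré dual `w ∈ H⁸(X(ℂ); ℤ)` of `W` for the complex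
orientations of the tree (`w ⌢ [X(ℂ)] = i(ℂ)_*[W(ℂ)]`, `HodgeTheory.complexOrientationInt`): there are
an abelian surface `A` (`A.dim = 2`), a smooth projective generalized Kummer variety `K` of `A`
(`IsGeneralizedKummerVarietyOf 4 A K`, file `GeneralizedKummerType` — the Albanese fibre of `A^[5]`,
Beauville), a Kummer fixed datum `(ι₀, W₀, i₀)` on `K` with integral Poincaré dual `w₀`, a group
isomorphism `θ : Γ(K) ≃* Γ(X)` (`Γ = autFixingH2H3`) and a `ℂ`-linear isomorphism
`P : H⁸(K(ℂ); ℂ) ≃ H⁸(X(ℂ); ℂ)` which is `θ`-equivariant for the representations `translationRep · 8`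
(`g ↦ (g⁻¹)^*`) and maps `w₀ ⊗ 1` to `w ⊗ 1`.  `P` is the composite of the parallel transports along a
chain of families realising `AreDeformationEquivalent 8 K X` (definition of the class), corrected by
one element of `Γ(X)` as explained above; `θ` is the induced identification of the stalks of
Hassett–Tschinkel's local system.  The statement records ONLY the existence of `(A, K, datum, θ, P)`
with these two properties — the weakest form the cell's transport of the Gram functional needs
(Summit-side `KummerFixedLocusKummerPointTransport`).  Stated for `n = 4` only.
`-- TODO(general form)`: `Kumⁿ`-type for all `n ≥ 2` (`m = ⌈n/2⌉`, `W` of `K3^[m]`-type), all degrees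
`Hᵏ`, compatibility with cup product and with the integral structure, and the statement for the full
local system `Aut°`.

## What is NOT here

No construction of parallel transport (the tree has no Gauss–Manin connection for
`AreDeformationEquivalent`); no claim about scheme-theoretic fixed loci on `X` (that is the cell's
residual); no claim that `P` preserves algebraic or Hodge classes other than `[W]`; no proof.
-/

noncomputable section

open CategoryTheory
open Literature.AlgebraicTopology.SingularHomology
open Literature.AlgebraicGeometry.HodgeTheory

namespace Literature.AlgebraicGeometry.Hyperkaehler

/-- **Hassett–Tschinkel 2013 Thm. 2.1 + Floccari 2026 Prop. 4.6 / Lem. 4.2 + Kamenova–Mongardi–Oblomkov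
2022 Cor. 4.4 (with Floccari 2023 §2.5): cohomological transport of the Kummer fixed fourfold and of
`Γ` from a Kummer point.**  For `X` smooth projective of `Kum⁴`-type, a Kummer fixed datum `(ι, W, i)`
on `X` and the integral Poincaré dual `w` of `W` (complex orientations), there are an abelian surface
`A`, a smooth projective generalized Kummer variety `K` of `A`, a Kummer fixed datum `(ι₀, W₀, i₀)` on
`K` with integral Poincaré dual `w₀`, a group isomorphism `θ : Γ(K) ≃* Γ(X)` and a `θ`-equivariant
linear isomorphism `P : H⁸(K(ℂ); ℂ) ≃ H⁸(X(ℂ); ℂ)` (for `g ↦ (g⁻¹)^*`) with `P (w₀ ⊗ 1) = w ⊗ 1`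
(module docstring for the verbatim statements, the rendering and what is not claimed).  A synthesis
of THEOREMS in print, unproved in the tree. [cite: HassettTschinkel2013, §2 Thm. 2.1]
[cite: Floccari2026, §4.4 Prop. 4.6 and §4.1 Lemma 4.2] [cite: KamenovaMongardiOblomkov2022, Def. 2.1 and Cor. 4.4]
[cite: Floccari2023, §2.5] -/
def HassettTschinkel2013_Floccari2026_fixedFourfoldClass_transport_kum4Type : Prop :=
  ∀ ⦃X : Motives.SchemeOver ℂ⦄ (hX : Motives.IsSmoothProjective 8 X), IsOfGeneralizedKummerType 4 X →
    ∀ (ι : Aut X) ⦃W : Motives.SchemeOver ℂ⦄ (hW : Motives.IsSmoothProjective 4 W) (i : W ⟶ X),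
      IsKummerFixedDatum X ι W i →
      ∀ (w : singularCohomology ℤ ℤ (Motives.ComplexPoints X) 8),
        capProduct (M := ℤ) (rfl : 8 + 8 = 16) w (complexOrientationInt hX).fundamentalClass =
          singularHomology.map ℤ ℤ (Motives.AlgPoints.mapContinuous (L := ℂ) i) 8
            (complexOrientationInt hW).fundamentalClass →
        ∃ (A : Motives.AbelianVariety ℂ) (K : Motives.SchemeOver ℂ)
          (hK8 : Motives.IsSmoothProjective 8 K), A.dim = 2 ∧ IsGeneralizedKummerVarietyOf 4 A K ∧
          ∃ (ι₀ : Aut K) (W₀ : Motives.SchemeOver ℂ) (hW₀ : Motives.IsSmoothProjective 4 W₀)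
            (i₀ : W₀ ⟶ K), IsKummerFixedDatum K ι₀ W₀ i₀ ∧
            ∃ (w₀ : singularCohomology ℤ ℤ (Motives.ComplexPoints K) 8),
              capProduct (M := ℤ) (rfl : 8 + 8 = 16) w₀ (complexOrientationInt hK8).fundamentalClass =
                singularHomology.map ℤ ℤ (Motives.AlgPoints.mapContinuous (L := ℂ) i₀) 8
                  (complexOrientationInt hW₀).fundamentalClass ∧
              ∃ (θ : autFixingH2H3 K ≃* autFixingH2H3 X) (P : complexBetti K 8 ≃ₗ[ℂ] complexBetti X 8),
                (∀ (g : autFixingH2H3 K) (c : complexBetti K 8),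
                  P (translationRep K 8 g c) = translationRep X 8 (θ g) (P c)) ∧
                P (singularCohomology.ringChange (algebraMap ℤ ℂ) (Motives.ComplexPoints K) 8 w₀) =
                  singularCohomology.ringChange (algebraMap ℤ ℂ) (Motives.ComplexPoints X) 8 w
-- TODO(general form): `Kumⁿ`-type for `n ≥ 2`, all degrees, cup product and integral structure, full `Aut°`.


end Literature.AlgebraicGeometry.Hyperkaehler

end
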